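import Summits.AtomisticToContinuum.Crystallization.Theses.TwoCentreKissingKernel

/-!
# `KernelGlue` for route TwoCentreKissingKernel (item stmt-AtomisticToContinuum-12083)

Finite-set bookkeeping: `SoftTwoCentreFourCommon → RobustTangencyBound → GapFreeShellRigidity`.

Given `η, S, x` as in `GapFreeShellRigidity`, let `N` be the soft shell of `x` (the points of `S`
other than `x` within `1 + η` of `x`; it has 12 elements) and `T` its translate by `-x`.  The soft
two-centre lemma applied to `Z = {w ∈ S | dist x w ≤ 4}` and each pair `(x, y)`, `y ∈ N`, yields
`≥ 4` points of `N` that are soft-tangent to `y`; hence every point of `T` has `≥ 4` soft-tangent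
partners in `T`, so `T` carries `≥ 12 · 4 = 48` ordered soft-tangent pairs and
`RobustTangencyBound` concludes.
-/

namespace Summit.AtomisticToContinuum.Crystallization.Theorems

open Summit.AtomisticToContinuum.Crystallization.Theses.TwoCentreKissingKernel

/-- Double counting of ordered pairs in a finite point configuration: if every point `a ∈ T` has at
least `k` partners `b ∈ T`, `b ≠ a`, with `dist a b ≤ r`, then `T` carries at least `T.card * k`
ordered pairs `(a, b)` of distinct points at distance `≤ r`. -/
theorem kernelGlue_card_pairs_ge {α : Type*} [MetricSpace α] (T : Finset α) (r : ℝ) (k : ℕ)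
    (h : ∀ a ∈ T, k ≤ {b ∈ (T : Set α) | b ≠ a ∧ dist a b ≤ r}.ncard) :
    T.card * k ≤ Nat.card {q : ↥T × ↥T // q.1 ≠ q.2 ∧ dist (q.1 : α) q.2 ≤ r} := by
  classical
  have hG : ∀ a ∈ T, k ≤ (T.filter (fun b => b ≠ a ∧ dist a b ≤ r)).card := by
    intro a ha
    rw [← Set.ncard_coe_finset, Finset.coe_filter]
    exact h a ha
  have hmem : ∀ p : ↥(T.sigma fun a => T.filter (fun b => b ≠ a ∧ dist a b ≤ r)),
      (p.1.1 ∈ T ∧ p.1.2 ∈ T) ∧ p.1.2 ≠ p.1.1 ∧ dist p.1.1 p.1.2 ≤ r := by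
    intro p
    have hp := p.2
    simp only [Finset.mem_sigma, Finset.mem_filter] at hp
    exact ⟨⟨hp.1, hp.2.1⟩, hp.2.2.1, hp.2.2.2⟩
  let f : ↥(T.sigma fun a => T.filter (fun b => b ≠ a ∧ dist a b ≤ r)) →
      {q : ↥T × ↥T // q.1 ≠ q.2 ∧ dist (q.1 : α) q.2 ≤ r} :=
    fun p => ⟨(⟨p.1.1, (hmem p).1.1⟩, ⟨p.1.2, (hmem p).1.2⟩),
      fun h' => (hmem p).2.1 (congrArg Subtype.val h').symm, (hmem p).2.2⟩
  have hf : Function.Injective f := by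
    intro p q hpq
    have h1 : p.1.1 = q.1.1 := congrArg (fun s => (s.1.1 : α)) hpq
    have h2 : p.1.2 = q.1.2 := congrArg (fun s => (s.1.2 : α)) hpq
    exact Subtype.ext (Sigma.ext h1 (heq_of_eq h2))
  calc T.card * k = T.card • k := (smul_eq_mul _ _).symm
    _ ≤ ∑ a ∈ T, (T.filter (fun b => b ≠ a ∧ dist a b ≤ r)).card :=
        Finset.card_nsmul_le_sum _ _ _ hG
    _ = (T.sigma fun a => T.filter (fun b => b ≠ a ∧ dist a b ≤ r)).card :=
        (Finset.card_sigma _ _).symm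
    _ = Nat.card ↥(T.sigma fun a => T.filter (fun b => b ≠ a ∧ dist a b ≤ r)) :=
        (Nat.card_eq_finsetCard _).symm
    _ ≤ Nat.card {q : ↥T × ↥T // q.1 ≠ q.2 ∧ dist (q.1 : α) q.2 ≤ r} :=
        Nat.card_le_card_of_injective f hf

/-- **KernelGlue** (item stmt-AtomisticToContinuum-12083 of route TwoCentreKissingKernel):
the soft two-centre lemma and effective 24-tangency rigidity together give the gap-free shell
rigidity kernel.  Pure finite-set bookkeeping. -/
theorem kernelGlue_proof :
    Summit.AtomisticToContinuum.Crystallization.Theses.TwoCentreKissingKernel.KernelGlue := by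
  unfold KernelGlue
  intro hSoft hRob η hη0 hη1 S x hx hsep h12
  -- the soft shell of `x`
  set N : Set (EuclideanSpace ℝ (Fin 3)) := {y ∈ S | y ≠ x ∧ dist x y ≤ 1 + η} with hN
  have hNcard : N.ncard = 12 := h12 x hx (by rw [dist_self]; linarith)
  have hNfin : N.Finite := Set.finite_of_ncard_ne_zero (by rw [hNcard]; norm_num)
  obtain ⟨T, hT⟩ : ∃ T : Finset (EuclideanSpace ℝ (Fin 3)),
      T = hNfin.toFinset.image (fun y => y - x) := ⟨_, rfl⟩
  have hmemT : ∀ t, t ∈ T ↔ ∃ y ∈ N, y - x = t := by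
    intro t
    simp only [hT, Finset.mem_image, Set.Finite.mem_toFinset]
  have hTcard : T.card = 12 := by
    rw [hT, Finset.card_image_of_injective _ sub_left_injective,
      ← Set.ncard_eq_toFinset_card N hNfin, hNcard]
  -- norms of the translated shell
  have hnorm : ∀ t ∈ T, 1 - η ≤ ‖t‖ ∧ ‖t‖ ≤ 1 + η := by
    intro t ht
    obtain ⟨y, ⟨hyS, hyx, hdy⟩, rfl⟩ := (hmemT t).1 ht
    rw [← dist_eq_norm, dist_comm]
    exact ⟨hsep x hx y hyS (by rw [dist_self]; norm_num) (by linarith) hyx.symm, hdy⟩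
  -- separation of the translated shell
  have hsepT : ∀ t ∈ T, ∀ t' ∈ T, t ≠ t' → 1 - η ≤ dist t t' := by
    intro t ht t' ht' hne
    obtain ⟨y, ⟨hyS, -, hdy⟩, rfl⟩ := (hmemT t).1 ht
    obtain ⟨y', ⟨hy'S, -, hdy'⟩, rfl⟩ := (hmemT t').1 ht'
    rw [dist_sub_right]
    exact hsep y hyS y' hy'S (by linarith) (by linarith) (fun h => hne (by rw [h]))
  -- every shell point has at least four soft-tangent partners in the shell
  have hfib : ∀ a ∈ T, 4 ≤ {b ∈ (T : Set (EuclideanSpace ℝ (Fin 3))) |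
      b ≠ a ∧ dist a b ≤ 1 + η}.ncard := by
    intro a ha
    obtain ⟨y, ⟨hyS, hyx, hdy⟩, rfl⟩ := (hmemT a).1 ha
    set Z : Set (EuclideanSpace ℝ (Fin 3)) := {w ∈ S | dist x w ≤ 4} with hZ
    have hZsep : ∀ u ∈ Z, ∀ v ∈ Z, u ≠ v → 1 - η ≤ dist u v :=
      fun u hu v hv huv => hsep u hu.1 v hv.1 hu.2 hv.2 huv
    have hxZ : x ∈ Z := ⟨hx, by rw [dist_self]; norm_num⟩
    have hyZ : y ∈ Z := ⟨hyS, by linarith⟩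
    have hZx : {w ∈ Z | w ≠ x ∧ dist w x ≤ 1 + η}.ncard = 12 := by
      have e : {w ∈ Z | w ≠ x ∧ dist w x ≤ 1 + η} = {w ∈ S | w ≠ x ∧ dist x w ≤ 1 + η} := by
        ext w
        constructor
        · rintro ⟨⟨hwS, -⟩, hwx, hd⟩
          exact ⟨hwS, hwx, by rwa [dist_comm]⟩
        · rintro ⟨hwS, hwx, hd⟩
          exact ⟨⟨hwS, by linarith⟩, hwx, by rwa [dist_comm]⟩
      rw [e]
      exact h12 x hx (by rw [dist_self]; linarith)
    have hZy : {w ∈ Z | w ≠ y ∧ dist w y ≤ 1 + η}.ncard = 12 := by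
      have e : {w ∈ Z | w ≠ y ∧ dist w y ≤ 1 + η} = {w ∈ S | w ≠ y ∧ dist y w ≤ 1 + η} := by
        ext w
        constructor
        · rintro ⟨⟨hwS, -⟩, hwy, hd⟩
          exact ⟨hwS, hwy, by rwa [dist_comm]⟩
        · rintro ⟨hwS, hwy, hd⟩
          refine ⟨⟨hwS, ?_⟩, hwy, by rwa [dist_comm]⟩
          calc dist x w ≤ dist x y + dist y w := dist_triangle x y w
            _ ≤ 4 := by linarith
      rw [e]
      exact h12 y hyS hdy
    have hC := hSoft η hη0 hη1 Z hZsep x hxZ y hyZ hyx.symm hdy hZx hZy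
    have hsub : (fun w => w - x) '' {w ∈ Z | w ≠ x ∧ w ≠ y ∧ dist w x ≤ 1 + η ∧ dist w y ≤ 1 + η}
        ⊆ {b ∈ (T : Set (EuclideanSpace ℝ (Fin 3))) | b ≠ y - x ∧ dist (y - x) b ≤ 1 + η} := by
      rintro _ ⟨w, ⟨⟨hwS, -⟩, hwx, hwy, hdx, hdy'⟩, rfl⟩
      refine ⟨?_, fun h => hwy (sub_left_injective h), ?_⟩
      · exact (Finset.mem_coe).2 ((hmemT _).2 ⟨w, ⟨hwS, hwx, by rwa [dist_comm]⟩, rfl⟩)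
      · rw [dist_sub_right, dist_comm]
        exact hdy'
    have hfinT : {b ∈ (T : Set (EuclideanSpace ℝ (Fin 3))) |
        b ≠ y - x ∧ dist (y - x) b ≤ 1 + η}.Finite :=
      (Finset.finite_toSet T).subset (fun b hb => hb.1)
    calc 4 ≤ {w ∈ Z | w ≠ x ∧ w ≠ y ∧ dist w x ≤ 1 + η ∧ dist w y ≤ 1 + η}.ncard := hC
      _ = ((fun w => w - x) ''
            {w ∈ Z | w ≠ x ∧ w ≠ y ∧ dist w x ≤ 1 + η ∧ dist w y ≤ 1 + η}).ncard :=
          (Set.ncard_image_of_injective _ sub_left_injective).symm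
      _ ≤ _ := Set.ncard_le_ncard hsub hfinT
  have hpairs : 48 ≤ Nat.card {q : ↥T × ↥T // q.1 ≠ q.2 ∧
      dist (q.1 : EuclideanSpace ℝ (Fin 3)) q.2 ≤ 1 + η} := by
    have := kernelGlue_card_pairs_ge T (1 + η) 4 hfib
    rw [hTcard] at this
    omega
  refine ⟨T, ?_, hRob η hη0 hη1 T hTcard hnorm hsepT hpairs⟩
  rw [hT, Finset.coe_image, Set.Finite.coe_toFinset]

end Summit.AtomisticToContinuum.Crystallization.Theorems
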